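import Literature.MathematicalPhysics.QuantumFieldTheory.Balaban1983to89.B9SectCLatticeCarrier

/-!
# `Balaban1983to89.B9Eq343ProfileChartLetters` — T. Bałaban, *Propagators for lattice gauge theories in a background field*, Commun. Math. Phys. **99** (1985)
# 389–434 [Balaban1985BackgroundPropagators] (3.43)–(3.46) p. 398, (3.1) p. 390 (the periodic lattice): **A PROFILE PLACED IN ONE CHART OF `ℤ∕N` — for
# `f : ℤ → ℝ` vanishing at `k ≤ 1` and at `k ≥ N − 2`, the coordinate profile `p(k) := f(k.val)` on `Fin N` inherits `f`'s difference-quotient letters ALONG THE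
# LATTICE STEPS `shift`∕`unshift` of `B9SectCLatticeCarrier` (the wrap-around step meets only zeros): the profile letters of `B9Eq343ProductCutoffLetters` §2 from
# the integer letters of `B9Eq343ProfileLetters`**

statement-level skeleton of published theorems with citation tags; proofs where landed; nothing here is a claim about the Yang–Mills mass gap

CITATION HEADER (lean-in-tree rule).  Audit cell `pub-balaban`, sub-cell `t4`, BINDER row NE9; filed by NE9 crux-team LEAF PROVER 05
(`b2b-balaban-t4-ne9-formalise-leaf-05`, gen 84).  SOURCE READ first-hand [Balaban1985BackgroundPropagators] p. 398 (3.43)–(3.46), p. 390 (3.1) — cites only;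
[folklore] modular arithmetic of one lattice step; nothing printed is a hypothesis.

WHAT IS PROVED (sorry-free; 0 `def`; [folklore]).  `N : Fin d → ℕ` positive, a direction `μ`, `f : ℤ → ℝ` with `f k = 0` for `k ≤ 1` and for `(N μ : ℤ) − 2 ≤ k`
(the profile sits inside the chart `{0, …, N_μ − 1}` away from its ends), the profile `k ↦ f k.val` on `Fin (N μ)` read at `x_μ`:
* §1 `val_shift_eq_or`, `val_unshift_eq_or` — the stepped coordinate is `v + 1` (resp. `v − 1`) or the wrap-around value, with the wrap case pinned down.
* §2 **`chart_first_letter_shift`**, **`chart_first_letter_unshift`**, **`chart_second_letter`** — `|t(f(k+1) − f(k))| ≤ c₁` (∀ k : ℤ) ⊢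
  `|t(p((x+e_μ)_μ) − p(x_μ))| ≤ c₁` and `|t(p(x_μ) − p((x−e_μ)_μ))| ≤ c₁`; `|t²(2f(k) − f(k+1) − f(k−1))| ≤ c₂` ⊢ the same along `shift`∕`unshift` — EXACTLY the
  profile letters `h1`∕`h2` of `B9Eq343ProductCutoffLetters.first_difference_letter_shift` ∕ `_unshift` ∕ `second_difference_letter` for `p μ := fun k => f k.val`.
HONEST SCOPE.  Bookkeeping; the integer letters come from `B9Eq343ProfileLetters` (a sampled `C^{1,1}` bump), the vanishing near the chart ends is the geometric
side condition «cube + margin inside one chart»; nothing of [B9] asserted.  NOT summit progress (cell pub-balaban: NE9 NOT PRINTED ∕ NOT PROVED; «NE9 ⇐ the named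
binders»; row WALLED ON A MODEL (O-NE9-1; #5 UNRULED); spine PROVED 0∕9; rung (B)+1 finite T⁴ — NOT infinite volume, NOT mass gap, NOT BetaPertH, NOT Clay).  HONEST
DEPENDENCY (cell line): continuum YM on T⁴ ⇐ BetaPertH ∧ nine spine estimates (0/9 proved); BetaPertH ⇐ (D1) ∧ (D4) ∧ CAP+tail; G-an2-4 gates asym, D1 and NE2/3/4.
NEW file importing `B9SectCLatticeCarrier` only; nothing modified.  Net new unproved facts: 0.
-/

noncomputable section

namespace Literature.MathematicalPhysics.QuantumFieldTheory.Balaban1983to89.B9Eq343ProfileChartLetters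

open B4Sect5Torus (TSite)
open B9SectCLatticeCarrier (shift unshift shift_apply_val unshift_apply_val)

variable {d : ℕ} {N : Fin d → ℕ}

/-! ## §1 The stepped coordinate: `v + 1` ∕ `v − 1`, or the wrap-around value -/

/-- forward: `((x + e_μ)_μ).val = x_μ.val + 1`, or (`x_μ.val + 1 = N_μ`) `= 0`. [folklore] [cite: Balaban1985BackgroundPropagators, (3.1) p.390] -/
theorem val_shift_eq_or (μ : Fin d) (x : TSite d N) :
    (((shift μ x) μ).val = (x μ).val + 1 ∧ (x μ).val + 1 < N μ) ∨ (((shift μ x) μ).val = 0 ∧ (x μ).val + 1 = N μ) := by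
  have hlt := (x μ).isLt
  rw [shift_apply_val]
  rcases Nat.lt_or_ge ((x μ).val + 1) (N μ) with h | h
  · exact Or.inl ⟨Nat.mod_eq_of_lt h, h⟩
  · have he : (x μ).val + 1 = N μ := by omega
    exact Or.inr ⟨by rw [he, Nat.mod_self], he⟩

/-- backward: `((x − e_μ)_μ).val = x_μ.val − 1` (`1 ≤ x_μ.val`), or (`x_μ.val = 0`) `= N_μ − 1`. [folklore] [cite: Balaban1985BackgroundPropagators, (3.1) p.390] -/
theorem val_unshift_eq_or (μ : Fin d) (x : TSite d N) :
    (((unshift μ x) μ).val = (x μ).val - 1 ∧ 1 ≤ (x μ).val) ∨ (((unshift μ x) μ).val = N μ - 1 ∧ (x μ).val = 0) := by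
  have hlt := (x μ).isLt
  rw [unshift_apply_val]
  rcases Nat.eq_zero_or_pos (x μ).val with h | h
  · refine Or.inr ⟨?_, h⟩
    rw [h, zero_add]; exact Nat.mod_eq_of_lt (by omega)
  · refine Or.inl ⟨?_, h⟩
    have he : (x μ).val + (N μ - 1) = (x μ).val - 1 + N μ := by omega
    rw [he, Nat.add_mod_right]; exact Nat.mod_eq_of_lt (by omega)

/-! ## §2 The letters along `shift` ∕ `unshift` from the integer letters and the vanishing near the chart ends -/

section Letters

variable (μ : Fin d) (f : ℤ → ℝ) (hf0 : ∀ k : ℤ, k ≤ 1 → f k = 0) (hfN : ∀ k : ℤ, (N μ : ℤ) - 2 ≤ k → f k = 0)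

include hf0 hfN in
/-- **FIRST LETTER, FORWARD.** [folklore] [cite: Balaban1985BackgroundPropagators, (3.43) p.398, (3.1) p.390] -/
theorem chart_first_letter_shift (t : ℝ) {c₁ : ℝ} (h1 : ∀ k : ℤ, |t * (f (k + 1) - f k)| ≤ c₁) (x : TSite d N) :
    |t * (f (((shift μ x) μ).val : ℤ) - f ((x μ).val : ℤ))| ≤ c₁ := by
  rcases val_shift_eq_or μ x with ⟨hv, _⟩ | ⟨hv, he⟩
  · rw [hv]; push_cast; exact h1 _
  · have hc : 0 ≤ c₁ := (abs_nonneg _).trans (h1 0)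
    rw [hv, hf0 ((0 : ℕ) : ℤ) (by norm_num), hfN ((x μ).val : ℤ) (by have := he; omega)]
    simpa using hc

include hf0 hfN in
/-- **FIRST LETTER, BACKWARD.** [folklore] [cite: Balaban1985BackgroundPropagators, (3.43) p.398, (3.1) p.390] -/
theorem chart_first_letter_unshift (t : ℝ) {c₁ : ℝ} (h1 : ∀ k : ℤ, |t * (f (k + 1) - f k)| ≤ c₁) (x : TSite d N) :
    |t * (f ((x μ).val : ℤ) - f (((unshift μ x) μ).val : ℤ))| ≤ c₁ := by
  rcases val_unshift_eq_or μ x with ⟨hv, h1le⟩ | ⟨hv, he⟩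
  · rw [hv]
    have e : (((x μ).val : ℕ) : ℤ) = (((x μ).val - 1 : ℕ) : ℤ) + 1 := by push_cast [Nat.cast_sub h1le]; ring
    rw [e]; exact h1 _
  · have hc : 0 ≤ c₁ := (abs_nonneg _).trans (h1 0)
    have hN : 1 ≤ N μ := by have := (x μ).isLt; omega
    rw [hv, he, hf0 ((0 : ℕ) : ℤ) (by norm_num), hfN ((N μ - 1 : ℕ) : ℤ) (by push_cast [Nat.cast_sub hN]; omega)]
    simpa using hc

include hf0 hfN in
/-- **SECOND LETTER.** [folklore] [cite: Balaban1985BackgroundPropagators, (3.43) p.398, (3.1) p.390] -/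
theorem chart_second_letter (t : ℝ) {c₂ : ℝ} (h2 : ∀ k : ℤ, |t ^ 2 * (2 * f k - f (k + 1) - f (k - 1))| ≤ c₂) (x : TSite d N) :
    |t ^ 2 * (2 * f ((x μ).val : ℤ) - f (((shift μ x) μ).val : ℤ) - f (((unshift μ x) μ).val : ℤ))| ≤ c₂ := by
  have hc : 0 ≤ c₂ := (abs_nonneg _).trans (h2 0)
  have hlt := (x μ).isLt
  rcases val_shift_eq_or μ x with ⟨hv, hvlt⟩ | ⟨hv, he⟩
  · rcases val_unshift_eq_or μ x with ⟨hw, h1le⟩ | ⟨hw, h0⟩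
    · -- genuine triple v−1, v, v+1
      rw [hv, hw]
      have e : (((x μ).val - 1 : ℕ) : ℤ) = ((x μ).val : ℤ) - 1 := by push_cast [Nat.cast_sub h1le]; ring
      rw [e]; push_cast; exact h2 _
    · -- v = 0: the triple (N−1, 0, 1) meets only zeros
      have hN : 1 ≤ N μ := by omega
      rw [hv, hw, h0, hf0 ((0 : ℕ) : ℤ) (by norm_num), hfN ((N μ - 1 : ℕ) : ℤ) (by push_cast [Nat.cast_sub hN]; omega)]
      have : f (((0 : ℕ) + 1 : ℕ) : ℤ) = 0 := hf0 _ (by norm_num)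
      rw [this]; simpa using hc
  · -- v = N−1: the triple (N−2, N−1, 0) meets only zeros
    rcases val_unshift_eq_or μ x with ⟨hw, h1le⟩ | ⟨hw, h0⟩
    · rw [hv, hw, hf0 ((0 : ℕ) : ℤ) (by norm_num), hfN ((x μ).val : ℤ) (by omega),
        hfN (((x μ).val - 1 : ℕ) : ℤ) (by push_cast [Nat.cast_sub h1le]; omega)]
      simpa using hc
    · -- N = 1: everything is the single site 0
      rw [hv, hw, h0, hf0 ((0 : ℕ) : ℤ) (by norm_num), hf0 ((N μ - 1 : ℕ) : ℤ) (by omega)]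
      simpa using hc

end Letters

end Literature.MathematicalPhysics.QuantumFieldTheory.Balaban1983to89.B9Eq343ProfileChartLetters

end
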